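import Mathlib.MeasureTheory.Integral.Prod
import Mathlib.MeasureTheory.Measure.Real

/-!
# Averaging an expectation over a family of law-preserving transformations (twist averaging)

Helper file for the crux `QuadrupoleSelectionRule` (stmt-CriticalPhenomena-7029, informal) of route
`CardyFlipRusso` (sub-problem `CardyFormulaZ2`), line `Sketch`: the abstract form of ideator 2's
first lemma `TwistAveraging` (card `twist-filter-scalar-gap`).  If every member `T a` of a jointly
measurable family of transformations preserves the law `μ`, then the `μ`-expectation of a bounded
observable equals the `μ`-expectation of its AVERAGE over the family (Fubini):

`∫ F dμ = (ν(A))⁻¹ ∫ ( ∫ F (T a x) ν(da) ) μ(dx)`.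

With `μ = P_B ⊗ P_W` the pair of Poisson laws of the hub, `T α` the simultaneous image map of the
twist homeomorphism by the angle `α` (law-preserving by `poissonPair_map_mapHomeomorph_eq`,
`CardyFlipRussoQuadrupoleSelectionRulePoissonTwist.lean`) and `ν` Lebesgue on `[0, 2π]`, this is
the identity `∫ F d(P_B⊗P_W) = ∫ (2π)⁻¹ ∫₀^{2π} F ∘ (twist by α) dα d(P_B⊗P_W)` of the card: the
annealed flip sum may be replaced by its rotational average disc by disc, which is where the
`C_m` / `U(1)` selection rule acts.
-/

noncomputable section

open MeasureTheory Set

namespace Summit.CriticalPhenomena.CardyFormulaZ2.Theorems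

/-- **Fubini for a law-preserving family.** For a probability measure `μ`, a finite measure `ν`
on the parameter space, a jointly measurable family `T` with `μ.map (T a) = μ` for every `a`, and
a bounded measurable observable `F`:
`∫ (∫ F (T a x) ν(da)) μ(dx) = ν(univ) · ∫ F dμ`. [folklore] -/
theorem integral_integral_comp_eq_mul_of_map_eq {X A : Type*} [MeasurableSpace X]
    [MeasurableSpace A] (μ : Measure X) [IsProbabilityMeasure μ] (ν : Measure A)
    [IsFiniteMeasure ν] (T : A → X → X) (hT : Measurable fun p : A × X => T p.1 p.2)
    (hinv : ∀ a, μ.map (T a) = μ) (F : X → ℝ) (hF : Measurable F) (M : ℝ)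
    (hM : ∀ x, |F x| ≤ M) :
    ∫ x, (∫ a, F (T a x) ∂ν) ∂μ = ν.real univ * ∫ x, F x ∂μ := by
  -- the integrand on the product `A × X`
  have hmeas : Measurable fun p : A × X => F (T p.1 p.2) := hF.comp hT
  have hint : Integrable (fun p : A × X => F (T p.1 p.2)) (ν.prod μ) := by
    refine Integrable.of_bound hmeas.aestronglyMeasurable M (Filter.Eventually.of_forall ?_)
    intro p
    simpa [Real.norm_eq_abs] using hM (T p.1 p.2)
  -- each `T a` is measurable (section of a jointly measurable map)
  have hTa : ∀ a, Measurable (T a) := fun a => hT.comp (measurable_const.prodMk measurable_id)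
  -- swap the integrals
  have hswap : ∫ x, (∫ a, F (T a x) ∂ν) ∂μ = ∫ a, (∫ x, F (T a x) ∂μ) ∂ν :=
    integral_integral_swap hint.swap
  rw [hswap]
  -- the inner integral does not depend on `a`
  have hinner : ∀ a, ∫ x, F (T a x) ∂μ = ∫ x, F x ∂μ := by
    intro a
    have h := integral_map (hTa a).aemeasurable (hF.aestronglyMeasurable (μ := μ.map (T a)))
    rw [hinv a] at h
    exact h.symm
  simp_rw [hinner, integral_const, smul_eq_mul]

/-- **Twist averaging** (`TwistAveraging` of card `twist-filter-scalar-gap`, abstract form): under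
the hypotheses of `integral_integral_comp_eq_mul_of_map_eq` with `ν(univ) ≠ 0`, the expectation of
`F` is the expectation of its average over the family,
`∫ F dμ = (ν(univ))⁻¹ ∫ (∫ F (T a x) ν(da)) μ(dx)`. [folklore] -/
theorem integral_eq_inv_mul_integral_average {X A : Type*} [MeasurableSpace X]
    [MeasurableSpace A] (μ : Measure X) [IsProbabilityMeasure μ] (ν : Measure A)
    [IsFiniteMeasure ν] (hν : ν.real univ ≠ 0) (T : A → X → X)
    (hT : Measurable fun p : A × X => T p.1 p.2) (hinv : ∀ a, μ.map (T a) = μ) (F : X → ℝ)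
    (hF : Measurable F) (M : ℝ) (hM : ∀ x, |F x| ≤ M) :
    ∫ x, F x ∂μ = (ν.real univ)⁻¹ * ∫ x, (∫ a, F (T a x) ∂ν) ∂μ := by
  rw [integral_integral_comp_eq_mul_of_map_eq μ ν T hT hinv F hF M hM, ← mul_assoc,
    inv_mul_cancel₀ hν, one_mul]

end Summit.CriticalPhenomena.CardyFormulaZ2.Theorems

end
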